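import Summits.ResolutionOfSingularities.ResolutionOfSingularities.Theorems.IsoDict
import Literature.RingTheory.MvPolynomial.HilbertFunctionPolynomialExtension
import HarnessLib

/-!
# IsoDict2 — decomp-res node «IsoDict» (lens-5 g33 rider «IsoDict», critic row 206; landing rider INBOX
2026-08-31T10:19:52Z), tree file 2/2 of the node

Content VERBATIM from the decomp-res lens-5 g33 rider «IsoDict» `HOME/decomp-res-lens-5/g33/landing/IsoDict.lean`
(9330831b, 516 l; = g33/IsoDict.lean; sha = PIN STATUS 10:16:17Z = CRITIC-LEDGER row 206); HOME =
run/shared/lean/pub/decomp-res; landing = critic LANDING RIDER row 206 (INBOX 2026-08-31T10:19:52Z) — provenance,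
critic text and the landing header in full in the first file, `IsoDict`.  `--kind proof --supports
stmt-ResolutionOfSingularities-31770`; no aside change, no item.

## This file

Continuation 2/2 of `IsoDict` (same namespace / sections of the node, cut at the tree's 400-line cap; section
variables / opens replayed): scopes `RootStage` — carries `exists_prime_over_le_idealOfVars`, `topLocus`,
`mem_topLocus_iff`, `isIsolatedIn_topLocus_origin_iff_isolatedTop`,
`isIsolatedIn_topLocus_origin_iff_isolatedTop_three`, `rootStage`, `topLocusOf_rootStage`,
`isIsolatedIn_topLocusOf_rootStage_iff_isolatedTop`.

[WRITER NOTE (decomp-res writer g13): file split only — the landing file is 516 lines, over the tree's 400-line cap,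
and has a single root namespace with no inner sections before §6, so it is cut by the cap between two declarations:
`IsoDict` (part 1) and `IsoDict2` (part 2, imports part 1; `section RootStage` = §6 whole in part 2); the file-level
`set_option autoImplicit false`, `noncomputable section` and `open … (…)` lines and the namespace-level `variable {K
: Type} [Field K] {n : ℕ}` are replayed in part 2; every declaration, docstring and `/-! ## §k -/` comment exactly
as in the landing file (each § comment travels with its first declaration).  CONSUMERS (lens-6 g29): import
`…Theorems.IsoDict2` to have the whole dictionary incl. `isIsolatedIn_topLocusOf_rootStage_iff_isolatedTop` in
scope.  No dedup deletions (pre-flight clean).]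

(Sources: Hironaka1964 Ch. III §3 (Zariski–Nagata via Hasse–Schmidt derivations); CossartJannsenSaito2020 Ch. 2
(Hironaka schemes, directrix); Hauser2010 §§C–D; CutkoskyResolutionBook2004 §7.)
-/

set_option autoImplicit false

noncomputable section

open MvPolynomial AlgebraicGeometry
open Literature.AlgebraicGeometry.Resolution (hasseDeriv hasseDeriv_X_pow hasseDeriv_eq_zero_of_mem_supported
  hasseDeriv_zero_apply idealOrder)
open Literature.AlgebraicGeometry.Resolution.Hauser2010 (ordZero natCast_le_ordZero_iff_forall_coeff)
open Literature.AlgebraicGeometry.Resolution.HironakaScheme (symbPow mem_symbPow_of_mem_pow hasseDeriv_mem_symbPow)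
open Literature.AlgebraicGeometry.Hironaka2017.SpecOrders (Zs shf le_idealOrder_shf_span_singleton_iff)
open Literature.AlgebraicGeometry.Hironaka2017.S02Preliminaries.CoordChart (origin isMaximal_idealOfVars)
open Literature.RingTheory.MvPolynomial (mem_idealOfVars_iff_constantCoeff_eq_zero X_mem_idealOfVars
  idealOfVars_ne_top)
open Summit.ResolutionOfSingularities.ResolutionOfSingularities.Theorems.ForcedTowerClasses (IsIsolatedIn)
open Summit.ResolutionOfSingularities.ResolutionOfSingularities.Theorems.TightDefectClasses (topIdeal IsolatedTop)
open Summit.ResolutionOfSingularities.ResolutionOfSingularities.Theorems.PIDim4.SymbolicPower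
  (hasseDeriv_mapDomain_rename mem_of_mem_symbPow)

namespace Summit.ResolutionOfSingularities.ResolutionOfSingularities.Theorems.IsoDict

variable {K : Type} [Field K] {n : ℕ}

-- [WRITER NOTE (decomp-res writer g13): the node's bookkeeping lemma `finSuccEquiv_rename_succ` (`finSuccEquiv K n (rename Fin.succ b) = Polynomial.C b`)
-- stood here; it is STATEMENT-IDENTICAL to the landed `Literature.RingTheory.MvPolynomial.finSuccEquiv_rename_succ`
-- (HilbertFunctionPolynomialExtension; gate dedup.landed, p820283) — deleted, that module imported, its two uses below qualified.]

/-- **GOING-UP**: for every prime `𝔭 ⊆ (u)` of `K[u]` there is a prime `𝔓 ⊆ (z, u)` of `K[z, u]` containing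
`z^q + F` (`q ≠ 0`, `F(0) = 0`) and contracting to `𝔭`.  (`K[u] → K[z, u]/(z^q + F)` is finite, `z^q + F` monic in
`z`: lift `𝔭`, then lift `𝔭 ⊆ (u)` above it; the top prime contracts to `(u)` and contains `z^q`, so it is `(z,
u)`.) (Sources: AtiyahMacdonald1969, Ch. 5, Thm. 5.11 (going-up).) -/
theorem exists_prime_over_le_idealOfVars {q : ℕ} (hq : q ≠ 0) (F : MvPolynomial (Fin n) K)
    (hF0 : constantCoeff F = 0) {𝔭 : Ideal (MvPolynomial (Fin n) K)} (h𝔭 : 𝔭.IsPrime)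
    (h𝔭m : 𝔭 ≤ MvPolynomial.idealOfVars (Fin n) K) :
    ∃ 𝔓 : Ideal (MvPolynomial (Fin (n + 1)) K), 𝔓.IsPrime ∧ hypZ q F ∈ 𝔓 ∧
      𝔓.comap (rename Fin.succ) = 𝔭 ∧ 𝔓 ≤ MvPolynomial.idealOfVars (Fin (n + 1)) K := by
  classical
  let f : Polynomial (MvPolynomial (Fin n) K) := Polynomial.X ^ q + Polynomial.C F
  have hfmonic : f.Monic := Polynomial.monic_X_pow_add_C F hq
  haveI : Module.Finite (MvPolynomial (Fin n) K) (AdjoinRoot f) := (AdjoinRoot.powerBasis' hfmonic).finite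
  let θ : MvPolynomial (Fin (n + 1)) K →+* AdjoinRoot f :=
    (AdjoinRoot.mk f).comp (finSuccEquiv K n).toAlgHom.toRingHom
  have hθapply : ∀ x, θ x = AdjoinRoot.mk f (finSuccEquiv K n x) := fun x => rfl
  have hθC : ∀ b : MvPolynomial (Fin n) K,
      θ (rename Fin.succ b) = algebraMap (MvPolynomial (Fin n) K) (AdjoinRoot f) b := by
    intro b
    rw [hθapply, Literature.RingTheory.MvPolynomial.finSuccEquiv_rename_succ, AdjoinRoot.algebraMap_eq,
      AdjoinRoot.mk_C]
  have hθP : θ (hypZ q F) = 0 := by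
    rw [hθapply, hypZ, map_add, map_pow, finSuccEquiv_X_zero,
      Literature.RingTheory.MvPolynomial.finSuccEquiv_rename_succ]
    exact AdjoinRoot.mk_self
  -- injectivity of `K[u] → K[u][z]/(f)`
  have hinj : Function.Injective (algebraMap (MvPolynomial (Fin n) K) (AdjoinRoot f)) := by
    rw [AdjoinRoot.algebraMap_eq]
    refine AdjoinRoot.of.injective_of_degree_ne_zero ?_
    rw [Polynomial.degree_X_pow_add_C (Nat.pos_of_ne_zero hq)]
    exact_mod_cast hq
  -- going-up, twice
  haveI := h𝔭
  obtain ⟨Q₀, -, hQ₀prime, hQ₀comap⟩ := Ideal.exists_ideal_over_prime_of_isIntegral 𝔭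
    (⊥ : Ideal (AdjoinRoot f)) (by rw [Ideal.comap_bot_of_injective _ hinj]; exact bot_le)
  haveI : (MvPolynomial.idealOfVars (Fin n) K).IsPrime := isMaximal_idealOfVars.isPrime
  haveI := hQ₀prime
  obtain ⟨Q₁, hQ₀₁, hQ₁prime, hQ₁comap⟩ := Ideal.exists_ideal_over_prime_of_isIntegral
    (MvPolynomial.idealOfVars (Fin n) K) Q₀ (hQ₀comap.le.trans h𝔭m)
  haveI := hQ₁prime
  -- contraction along `θ ∘ rename succ = algebraMap`
  have hcomap : ∀ Q : Ideal (AdjoinRoot f),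
      (Q.comap θ).comap (rename Fin.succ) = Q.comap (algebraMap (MvPolynomial (Fin n) K) (AdjoinRoot f)) := by
    intro Q
    ext b
    simp only [Ideal.mem_comap, hθC]
  refine ⟨Q₀.comap θ, Ideal.comap_isPrime θ Q₀, ?_, ?_, ?_⟩
  · rw [Ideal.mem_comap, hθP]
    exact (Q₀.comap θ).zero_mem |> fun _ => Q₀.zero_mem
  · rw [hcomap, hQ₀comap]
  · have h1 : Q₀.comap θ ≤ Q₁.comap θ := Ideal.comap_mono hQ₀₁
    refine h1.trans (le_of_eq ?_)
    have hprime : (Q₁.comap θ).IsPrime := Ideal.comap_isPrime θ Q₁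
    refine ((isMaximal_idealOfVars (k := K) (σ := Fin (n + 1))).eq_of_le hprime.ne_top ?_).symm
    have hu : ∀ j : Fin n, (X j.succ : MvPolynomial (Fin (n + 1)) K) ∈ Q₁.comap θ := by
      intro j
      have hj : (X j : MvPolynomial (Fin n) K) ∈
          Q₁.comap (algebraMap (MvPolynomial (Fin n) K) (AdjoinRoot f)) := by
        rw [hQ₁comap]
        exact X_mem_idealOfVars j
      rw [← hcomap, Ideal.mem_comap, rename_X] at hj
      exact hj
    have hFQ : rename Fin.succ F ∈ Q₁.comap θ := by
      have hF1 : F ∈ Q₁.comap (algebraMap (MvPolynomial (Fin n) K) (AdjoinRoot f)) := by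
        rw [hQ₁comap, mem_idealOfVars_iff_constantCoeff_eq_zero]
        exact hF0
      rw [← hcomap, Ideal.mem_comap] at hF1
      exact hF1
    have hPQ : hypZ q F ∈ Q₁.comap θ := by
      rw [Ideal.mem_comap, hθP]
      exact Q₁.zero_mem
    have hz : (X 0 : MvPolynomial (Fin (n + 1)) K) ∈ Q₁.comap θ := by
      have h' := sub_mem hPQ hFQ
      rw [hypZ, add_sub_cancel_right] at h'
      exact hprime.mem_of_pow_mem q h'
    rw [MvPolynomial.idealOfVars, Ideal.span_le]
    rintro _ ⟨i, rfl⟩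
    rw [SetLike.mem_coe]
    exact Fin.cases hz (fun j => hu j) i

/-! ## §5 The scheme side: the top locus on `Spec K[z, u]` and the dictionary -/

/-- The TOP LOCUS `{y | q ≤ ord_y (z^q + F)}` of the hypersurface `z^q + F` on `Spec K[z, u]` (affine currency
`Zs`/`shf` of `Hironaka2017.Lib.SpecOrders`). DEFINITION (support). (Sources:
BierstoneGrigorievMilmanWlodarczyk2011, §3.1 p. 6.) -/
def topLocus (q : ℕ) (F : MvPolynomial (Fin n) K) : Set (Zs (MvPolynomial (Fin (n + 1)) K)) :=
  {y | ((q : ℕ) : ℕ∞) ≤ idealOrder (shf (MvPolynomial (Fin (n + 1)) K) (Ideal.span {hypZ q F})) y}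

/-- Membership in the top locus = symbolic `q`-foldness `z^q + F ∈ 𝔓^{(q)}`. (Sources: ZariskiSamuel1960, Vol. I Ch.
IV §12 (symbolic powers) and Vol. II Ch. VIII §1 (orders).) -/
theorem mem_topLocus_iff {q : ℕ} {F : MvPolynomial (Fin n) K} (y : Zs (MvPolynomial (Fin (n + 1)) K)) :
    y ∈ topLocus q F ↔ hypZ q F ∈ symbPow K y.asIdeal q := by
  rw [topLocus, Set.mem_setOf_eq, le_idealOrder_shf_span_singleton_iff]
  rfl

/-- **THE ISOLATION DICTIONARY (MAPPORT spec (iii)).**  `K` perfect of characteristic `p`, `q = pᵉ`,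
`F ∈ K[u₁, …, uₙ]` with `ord₀ F ≥ q`.  The origin of `Spec K[z, u]` is a (Zariski-)ISOLATED point of the top locus
`{y | q ≤ ord_y (z^q + F)}` (`ForcedTowerClasses.IsIsolatedIn`) **iff** the origin of the E-model is isolated in
`V(J_F)` (`TightDefectClasses.IsolatedTop q F`). (Sources: EGAIV4, Thm. 16.11.2; Dietel2015, Lemma (9.1.4) p. 108;
AtiyahMacdonald1969, Ch. 5, Thm. 5.11 (going-up).) -/
theorem isIsolatedIn_topLocus_origin_iff_isolatedTop [DecidableEq K] [PerfectField K] {p : ℕ} (hp : p.Prime)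
    [CharP K p] (e : ℕ) (F : MvPolynomial (Fin n) K) (hF : ((p ^ e : ℕ) : ℕ∞) ≤ ordZero F) :
    IsIsolatedIn (topLocus (p ^ e) F) (origin K (Fin (n + 1))) ↔ IsolatedTop (p ^ e) F := by
  classical
  have hq : p ^ e ≠ 0 := pow_ne_zero e hp.ne_zero
  have hF0 : constantCoeff F = 0 := by
    have h0 := (natCast_le_ordZero_iff_forall_coeff F (p ^ e)).mp hF 0
      (by rw [map_zero]; exact Nat.pos_of_ne_zero hq)
    rw [← h0]
    exact congrFun constantCoeff_eq F
  constructor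
  · intro hiso
    by_contra hnot
    obtain ⟨𝔭, h𝔭, hJ𝔭, h𝔭m, h𝔭ne⟩ := exists_prime_of_not_isolatedTop hnot
    obtain ⟨𝔓, h𝔓, hP𝔓, h𝔓comap, h𝔓le⟩ := exists_prime_over_le_idealOfVars hq F hF0 h𝔭 h𝔭m
    have h𝔓ne : 𝔓 ≠ MvPolynomial.idealOfVars (Fin (n + 1)) K := by
      rintro rfl
      rw [comap_rename_succ_idealOfVars] at h𝔓comap
      exact h𝔭ne h𝔓comap.symm
    haveI := h𝔓
    have hJ' : (topIdeal (p ^ e) F).map (rename Fin.succ) ≤ 𝔓 :=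
      Ideal.map_le_iff_le_comap.mpr (hJ𝔭.trans h𝔓comap.ge)
    let ζ : Zs (MvPolynomial (Fin (n + 1)) K) := ⟨𝔓, h𝔓⟩
    have hmem : ζ ∈ topLocus (p ^ e) F := (mem_topLocus_iff ζ).mpr (hypZ_mem_symbPow hp e F hP𝔓 hJ')
    have hspec : ζ ⤳ origin K (Fin (n + 1)) := (PrimeSpectrum.le_iff_specializes ζ _).mp h𝔓le
    have hne : ζ ≠ origin K (Fin (n + 1)) := fun h => h𝔓ne (congrArg PrimeSpectrum.asIdeal h)
    exact HugValuationCut.not_isIsolatedIn_of_specializes hspec hne hmem hiso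
  · rintro ⟨N, g, hg0, hg⟩
    haveI : (MvPolynomial.idealOfVars (Fin (n + 1)) K).IsPrime := isMaximal_idealOfVars.isPrime
    refine ⟨?_, ⟨⟨{y | rename Fin.succ g ∉ y.asIdeal}, ?_⟩, ?_, ?_⟩⟩
    · exact (mem_topLocus_iff _).mpr (mem_symbPow_of_mem_pow idealOfVars_ne_top (hypZ_mem_idealOfVars_pow hF))
    · exact (PrimeSpectrum.basicOpen (rename Fin.succ g)).isOpen
    · show rename Fin.succ g ∉ MvPolynomial.idealOfVars (Fin (n + 1)) K
      rw [mem_idealOfVars_iff_constantCoeff_eq_zero, constantCoeff_rename]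
      exact hg0
    · rintro y ⟨hyU, hyS⟩
      rw [Set.mem_singleton_iff]
      haveI := y.isPrime
      exact PrimeSpectrum.ext
        (eq_idealOfVars_of_mem_symbPow hq hF0 hg hyU ((mem_topLocus_iff y).mp hyS))

/-- The E-model instance `n = 3` (three `u`-variables), as consumed by the MAP-tower port. [folklore] -/
theorem isIsolatedIn_topLocus_origin_iff_isolatedTop_three [DecidableEq K] [PerfectField K] {p : ℕ}
    (hp : p.Prime) [CharP K p] (e : ℕ) (F : MvPolynomial (Fin 3) K) (hF : ((p ^ e : ℕ) : ℕ∞) ≤ ordZero F) :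
    IsIsolatedIn (topLocus (p ^ e) F) (origin K (Fin 4)) ↔ IsolatedTop (p ^ e) F :=
  isIsolatedIn_topLocus_origin_iff_isolatedTop hp e F hF

section RootStage

open Summit.ResolutionOfSingularities.ResolutionOfSingularities.Theorems.DeltaCutClasses (Stage topLocusOf)

/-! ## §6 lens-6's LITERAL CURRENCY: the affine root stage (`DeltaCutClasses.Stage`, `DeltaCutClasses.topLocusOf`)

`DeltaCutRun.Stage = ⟨Y, I⟩` and `DeltaCutSep.topLocusOf n N = {y | n ≤ idealOrder N.I y}` (Theorems/DeltaCutSep.lean:188) use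
the SAME Literature `idealOrder`; for the affine root stage `N₀ := ⟨Zs K[z,u], shf _ 𝓘(z^q + F(u))⟩` lens-6's top locus IS
`topLocus q F` by `rfl`, so the dictionary reads verbatim in the scheme side's letters (lens-6 g28 INBOX 2026-08-31T10:11:35Z:
«keep MvPolynomial (Fin (3+1)) K … your set is `topLocusOf q N₀` by rfl … consumer `badThread_pt_isolated_iff_isolatedTop`»). -/

/-- **THE AFFINE ROOT STAGE** `⟨Spec K[z, u], 𝓘(z^q + F(u))⟩` of the E-model hypersurface, in lens-6's `Stage` currency.
DEFINITION (support). -/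
def rootStage (q : ℕ) (F : MvPolynomial (Fin n) K) : Stage :=
  ⟨Zs (MvPolynomial (Fin (n + 1)) K), shf (MvPolynomial (Fin (n + 1)) K) (Ideal.span {hypZ q F})⟩

/-- lens-6's `topLocusOf q (rootStage q F)` IS `topLocus q F`, definitionally. [folklore] -/
theorem topLocusOf_rootStage (q : ℕ) (F : MvPolynomial (Fin n) K) :
    topLocusOf q (rootStage q F) = topLocus q F := rfl

/-- **THE ISOLATION DICTIONARY IN `Stage` CURRENCY** (MAPPORT (iii), the (T-bridge) load-bearing lemma as lens-6 consumes
it): for `K` perfect of characteristic `p`, `q = p^e`, `ord₀ F ≥ q`, the origin of the root stage is Zariski-isolated in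
lens-6's top locus `topLocusOf q (rootStage q F)` iff `F` is E-isolated (`TightDefectClasses.IsolatedTop q F`).
[DECIDED — PROVED] [folklore] -/
theorem isIsolatedIn_topLocusOf_rootStage_iff_isolatedTop [DecidableEq K] [PerfectField K] {p : ℕ} (hp : p.Prime)
    [CharP K p] (e : ℕ) (F : MvPolynomial (Fin n) K) (hF : ((p ^ e : ℕ) : ℕ∞) ≤ ordZero F) :
    IsIsolatedIn (topLocusOf (p ^ e) (rootStage (p ^ e) F)) (origin K (Fin (n + 1))) ↔ IsolatedTop (p ^ e) F :=
  isIsolatedIn_topLocus_origin_iff_isolatedTop hp e F hF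

end RootStage

end Summit.ResolutionOfSingularities.ResolutionOfSingularities.Theorems.IsoDict
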